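import Literature.MathematicalPhysics.QuantumFieldTheory.Balaban1983to89.B12Eq118Analyticity263

/-!
# DressedRitz ★20205 — crux idea «cauchy-parity» (crux-ideate #1, round 1, seat ym-cruxidea-20205-1 GEN 2): FIRST LEMMA

LEVER.  The tolerance structure of `LuscherReduction.DressedRitz` — two-sided level RATIOS to `exp(±C·Λ²/L)` ((E5)/(o5)),
residual `C·Λ³/L²` ((E6)), NEAR leakage `O(λ)`, variational cap `exp(η·Λ/L)` ((o7)) — is SECOND-ORDER TAYLOR CONTROL at
`|θ| ≍ Λ = luscherLambda β L` of the holonomy (zero-mode) dependence of TOP-SCALE localized terms of a Bałaban tower, obtained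
from three pieces of O(1)-GRADE information only:
 (a) the bound (1.18) `|𝐄^{(j)}(X,·)| ≤ E₀ e^{−κ d_j(X)}` on the complex space `U^c_j(X, α₀, α₁)` with ABSOLUTE `α₀, α₁`
     ([Balaban1987RG1] p. 263; tree: `Step.SFHyp.bound118`),
 (b) analyticity on that space ([Balaban1987RG1] (1.9) p. 261 / p. 263; tree: `B12.Eq118Analyticity263.SFHypAnalytic`),
 (c) evenness under lattice inversion `θ ↦ −θ` (Euclidean covariance, p. 263) and `G^c`-gauge invariance (1.19) + local
     dependence (1.7) (tree: `Step.SFHyp.gaugeInv119`, `Step.SFHyp.localDep`),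
via the order-2 Schwarz lemma: an even holomorphic function with oscillation `≤ M` on a disc of radius `r` moves by at most
`M·(|θ|/r)²`.  With `r = O(1)` (absolute `α₁` × the O(1) number of top blocks around the torus) and `|θ| ≍ Λ` this is
`O(Λ²)` per top block = `O(Λ²/L)` per fine time step: the (E5) exponent, WITHOUT computing any effective-potential
coefficient (no Lüscher `κ_i`, no one-loop `ε′_j`).  Contractible localization domains see a flat background only through a
gauge orbit, hence carry NO holonomy dependence (`holonomyBlind`); only wrapping domains do, and those below the top scale are
suppressed by `e^{−κ d_j(X)}` with `d_j(X) ≥` (torus size in j-units).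

WHAT IS PROVED HERE (0 sorry): §1 the complex-analysis engine (`norm_le_mul_sq_of_mapsTo_ball` = order-2 Schwarz, copied
from `Literature…T4PathwiseCouplingComplex`; `deriv_eq_zero_of_even`; `norm_sub_le_of_even`); §2 its docking onto the
tree's typed Bałaban small-field inductive hypotheses: `holonomyBlind` (localDep + (1.19) ⇒ a term whose domain sees the
θ-background as a gauge transform of the reference is θ-independent) and `holonomyTaylorTwo` ((1.18) + analyticity +
evenness along a holomorphic one-parameter family into the space ⇒ `‖𝐄(γ t) − 𝐄(γ 0)‖ ≤ 2E₀e^{−κd_j(X)}·(‖t‖/r)²`).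
NOT proved, NOT typeable over tree declarations today (the line's RG asks, see the card): that the femto-window transfer
spectrum below the gluon threshold is governed by a tower reaching the top scale `L` whose E-terms satisfy (a)–(c) with
absolute `α₀, α₁` ([Balaban1988Convergent] (2.28) uses `α_{i,j} = g_j C_i (log g_j^{−2})^{q_i}` instead — the card's
why-might-fail), and the zero-mode reduction turning top-block terms into the one-site operator `oneSiteCoupling β L`.
-/

noncomputable section

open Metric Set Filter Asymptotics
open scoped Topology

namespace Summit.QuantumFields.YangMills.Cruxes.DressedRitz.CauchyParity

/-! ## §1  The engine: even + holomorphic + bounded oscillation ⇒ second-order control -/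

/-- [folklore] **Order-2 Schwarz lemma** (proof copied from
`Literature.MathematicalPhysics.QuantumFieldTheory.Balaban1983to89.T4PathwiseCouplingComplex.norm_le_mul_sq_of_mapsTo_ball`):
`G` holomorphic on `‖z‖ < r` with values in `‖w‖ ≤ M`, `G 0 = 0`, `G′ 0 = 0` ⇒ `‖G z‖ ≤ M·(‖z‖/r)²`. -/
theorem norm_le_mul_sq_of_mapsTo_ball {G : ℂ → ℂ} {r M : ℝ} (hd : DifferentiableOn ℂ G (ball 0 r))
    (hmaps : MapsTo G (ball 0 r) (closedBall 0 M)) (hG0 : G 0 = 0) (hG1 : HasDerivAt G 0 0)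
    {z : ℂ} (hz : z ∈ ball (0 : ℂ) r) : ‖G z‖ ≤ M * (‖z‖ / r) ^ 2 := by
  have hn : (fun w => G w - G 0) =o[𝓝 (0 : ℂ)] fun w => ‖w - 0‖ ^ 1 := by
    have h := hasDerivAt_iff_isLittleO.mp hG1
    have h' : (fun w => G w - G 0) =o[𝓝 (0 : ℂ)] fun w => w - 0 :=
      h.congr_left fun w => by simp
    exact h'.norm_right.congr_right fun w => by simp
  have hmaps' : MapsTo G (ball 0 r) (closedBall (G 0) M) := by rw [hG0]; exact hmaps
  have h := Complex.dist_le_mul_div_pow_of_mapsTo_ball_of_isLittleO (n := 1) hd hmaps' hn hz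
  simpa [hG0, dist_zero_right] using h

/-- [folklore] A function that is even on a neighbourhood `‖z‖ < r` of `0` has `deriv F 0 = 0`. -/
theorem deriv_eq_zero_of_even {F : ℂ → ℂ} {r : ℝ} (hr : 0 < r)
    (heven : ∀ z ∈ ball (0 : ℂ) r, F (-z) = F z) : deriv F 0 = 0 := by
  have hEq : F =ᶠ[𝓝 (0 : ℂ)] fun z => F (-z) := by
    filter_upwards [ball_mem_nhds (0 : ℂ) hr] with z hz
    exact (heven z hz).symm
  have h1 : deriv F 0 = deriv (fun z => F (-z)) 0 := hEq.deriv_eq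
  rw [deriv_comp_neg, neg_zero] at h1
  have h2 : (2 : ℂ) * deriv F 0 = 0 := by linear_combination h1
  simpa using h2

/-- [folklore] **Cauchy–parity tolerance (engine).**  `f` holomorphic on `‖z‖ < r`, with oscillation `‖f z − f 0‖ ≤ M`
there, and EVEN there ⇒ `‖f z − f 0‖ ≤ M·(‖z‖/r)²`: an O(1) sup bound on an O(1) disc is second-order precision at
small argument — the mechanism by which O(1)-grade RG bounds deliver the `exp(±CΛ²/L)` tolerance of DressedRitz. -/
theorem norm_sub_le_of_even {f : ℂ → ℂ} {r M : ℝ} (hr : 0 < r)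
    (hf : DifferentiableOn ℂ f (ball 0 r))
    (hM : ∀ z ∈ ball (0 : ℂ) r, ‖f z - f 0‖ ≤ M)
    (heven : ∀ z ∈ ball (0 : ℂ) r, f (-z) = f z)
    {z : ℂ} (hz : z ∈ ball (0 : ℂ) r) : ‖f z - f 0‖ ≤ M * (‖z‖ / r) ^ 2 := by
  set G : ℂ → ℂ := fun w => f w - f 0 with hG
  have hd : DifferentiableOn ℂ G (ball 0 r) := hf.sub_const _
  have hmaps : MapsTo G (ball 0 r) (closedBall 0 M) := fun w hw => by
    simpa [hG, mem_closedBall_zero_iff] using hM w hw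
  have hG0 : G 0 = 0 := by simp [hG]
  have hGeven : ∀ w ∈ ball (0 : ℂ) r, G (-w) = G w := fun w hw => by simp [hG, heven w hw]
  have hdiff0 : DifferentiableAt ℂ G 0 := hd.differentiableAt (ball_mem_nhds (0 : ℂ) hr)
  have hG1 : HasDerivAt G 0 0 := by
    have h := hdiff0.hasDerivAt
    rwa [deriv_eq_zero_of_even hr hGeven] at h
  simpa [hG] using norm_le_mul_sq_of_mapsTo_ball hd hmaps hG0 hG1 hz

/-- The real-parameter reading used by the line: for a real holonomy angle `θ` with `|θ| < r`,
`‖f θ − f 0‖ ≤ M·θ²/r²`. -/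
theorem norm_sub_le_of_even_real {f : ℂ → ℂ} {r M : ℝ} (hr : 0 < r)
    (hf : DifferentiableOn ℂ f (ball 0 r))
    (hM : ∀ z ∈ ball (0 : ℂ) r, ‖f z - f 0‖ ≤ M)
    (heven : ∀ z ∈ ball (0 : ℂ) r, f (-z) = f z)
    {θ : ℝ} (hθ : |θ| < r) : ‖f θ - f 0‖ ≤ M * θ ^ 2 / r ^ 2 := by
  have hz : (θ : ℂ) ∈ ball (0 : ℂ) r := by
    simpa [mem_ball_zero_iff, Complex.norm_real] using hθ
  have h := norm_sub_le_of_even hr hf hM heven hz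
  have hn : ‖(θ : ℂ)‖ = |θ| := by simp [Complex.norm_real]
  rw [hn, div_pow, sq_abs] at h
  simpa [mul_div_assoc] using h

/-! ## §2  Docking onto the tree's typed Bałaban small-field hypotheses ([Balaban1987RG1] §1, `Step.SFHyp`) -/

open Literature.MathematicalPhysics.QuantumFieldTheory.Balaban1983to89
open Literature.MathematicalPhysics.QuantumFieldTheory.Balaban1983to89.Step
open Literature.MathematicalPhysics.QuantumFieldTheory.Balaban1983to89.B12.Eq118Analyticity263

variable {P : Params} {G : Type*} [GaugeGroup G] {Φ 𝒢 : Type*}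

/-- **Contractible blindness** ((1.7) local dependence + (1.19) `G^c`-gauge invariance): if, restricted to the localization
domain `X`, the configuration `φθ` agrees with a gauge transform of the reference `φ₀` — as a FLAT background does on every
domain that does not wrap the torus — then the term of `X` takes the same value on `φθ` and on `φ₀`: it carries no holonomy
dependence at all. [cite: Balaban1987RG1, (1.7) p.261, (1.19) p.263] -/
theorem holonomyBlind {T : SFTower P G Φ 𝒢} {c : SFConsts} {k j : ℕ} (hH : SFHyp T c k)
    (h1 : 1 ≤ j) (hj : j ≤ k) (X : (T.sys j).Dom) (g : ℝ) {φθ φ₀ : Φ} {u : 𝒢}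
    (hloc : T.agreeOn j X φθ (T.act u φ₀)) : T.E j X g φθ = T.E j X g φ₀ := by
  rw [hH.localDep j h1 hj X g _ _ hloc, hH.gaugeInv119 j h1 hj X g u φ₀]

/-- **Wrapping suppression below the top scale** (just (1.18) read on a wrapping domain): a term whose localization domain
has linear size `d_j(X) ≥ N` (as every domain that wraps a torus of `N` j-blocks does) is bounded by `E₀ e^{−κ N}` on the
space — so holonomy dependence generated at scale `j` is `O(e^{−κ N_j})`, negligible until `N_j = O(1)` (the top scales). -/
theorem wrapping_bound {T : SFTower P G Φ 𝒢} {c : SFConsts} {k j : ℕ} (hH : SFHyp T c k)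
    (h1 : 1 ≤ j) (hj : j ≤ k) (X : (T.sys j).Dom) {g : ℝ} (hg0 : 0 ≤ g) (hgγ : g ≤ c.γ)
    (hE₀ : 0 ≤ c.E₀) (hκ : 0 ≤ c.κ) {N : ℝ} (hN : N ≤ (T.sys j).dj X)
    {φ : Φ} (hφ : φ ∈ T.space j X c.α₀ c.α₁) :
    ‖T.E j X g φ‖ ≤ c.E₀ * Real.exp (-c.κ * N) := by
  have h := hH.bound118 j h1 hj X g φ hg0 hgγ hφ
  have hexp : Real.exp (-c.κ * (T.sys j).dj X) ≤ Real.exp (-c.κ * N) :=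
    Real.exp_le_exp.mpr (by nlinarith)
  exact h.trans (mul_le_mul_of_nonneg_left hexp hE₀)

variable [NormedAddCommGroup Φ] [NormedSpace ℂ Φ]

/-- **Cauchy–parity tolerance over (1.18)** : along any holomorphic one-parameter family `γl : ℂ → Φ` (the complexified
holonomy angle `t ↦ U_t`) that stays inside `U^c_j(X, α₀, α₁)` for `‖t‖ < r`, and on which the term is even, the bound (1.18)
and the analyticity clause give `‖𝐄^{(j)}(X, g, γl t) − 𝐄^{(j)}(X, g, γl 0)‖ ≤ 2·E₀·e^{−κ d_j(X)}·(‖t‖/r)²`.  With `r`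
absolute (p. 263: *«absolute constants α₀, α₁»*) and `‖t‖ ≍ Λ` this is the `O(Λ²)`-per-top-block precision of (E5)/(o5).
[cite: Balaban1987RG1, (1.18)–(1.19) p.263, (3.15) p.273] -/
theorem holonomyTaylorTwo {T : SFTower P G Φ 𝒢} {c : SFConsts} {k j : ℕ} (hH : SFHyp T c k)
    (hA : SFHypAnalytic T c k) (h1 : 1 ≤ j) (hj : j ≤ k) (X : (T.sys j).Dom) {g : ℝ} (hg0 : 0 ≤ g)
    (hgγ : g ≤ c.γ) {γl : ℂ → Φ} {r : ℝ} (hr : 0 < r) (hγ : AnalyticOnNhd ℂ γl (ball 0 r))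
    (hmaps : MapsTo γl (ball 0 r) (T.space j X c.α₀ c.α₁))
    (heven : ∀ t ∈ ball (0 : ℂ) r, T.E j X g (γl (-t)) = T.E j X g (γl t))
    {t : ℂ} (ht : t ∈ ball (0 : ℂ) r) :
    ‖T.E j X g (γl t) - T.E j X g (γl 0)‖
      ≤ 2 * (c.E₀ * Real.exp (-c.κ * (T.sys j).dj X)) * (‖t‖ / r) ^ 2 := by
  have hdiff : DifferentiableOn ℂ (fun s => T.E j X g (γl s)) (ball 0 r) :=
    hA.differentiableOn_E_line h1 hj X hg0 hgγ hγ hmaps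
  have hB : ∀ s ∈ ball (0 : ℂ) r, ‖T.E j X g (γl s)‖ ≤ c.E₀ * Real.exp (-c.κ * (T.sys j).dj X) :=
    fun s hs => hH.bound118 j h1 hj X g _ hg0 hgγ (hmaps hs)
  have h0 : (0 : ℂ) ∈ ball (0 : ℂ) r := mem_ball_self hr
  have hM : ∀ s ∈ ball (0 : ℂ) r,
      ‖T.E j X g (γl s) - T.E j X g (γl 0)‖ ≤ 2 * (c.E₀ * Real.exp (-c.κ * (T.sys j).dj X)) :=
    fun s hs => (norm_sub_le _ _).trans (by linarith [hB s hs, hB 0 h0])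
  exact norm_sub_le_of_even (f := fun s => T.E j X g (γl s)) hr hdiff hM heven ht

end Summit.QuantumFields.YangMills.Cruxes.DressedRitz.CauchyParity
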